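import Summits.AnomalousDissipation.AnomalousDissipation.Theorems.MomentParityCubicParityLoudNoCasimirCertificateScaling
import Summits.AnomalousDissipation.AnomalousDissipation.Theorems.CubicParityLoud.Negative.MeanFlow
import Summits.AnomalousDissipation.AnomalousDissipation.Theorems.MomentParityQuarticGateSignLemma
import Summits.AnomalousDissipation.AnomalousDissipation.Theorems.MomentParityQuarticGateTransport
import Literature.Analysis.FluidPDE.OnsagerBDSVBiotSavart
import Literature.Analysis.FluidPDE.BeltramiWavesCurl

/-!
# Stub `stub_noCasimirCertificate` (S4) of the line `farkas-split-menu`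
# (crux `MomentParity.CubicParityLoud`, stmt-AnomalousDissipation-11465)

**The menu kills every Casimir-based certificate.** Fix a smooth force `f`, `ν > 0`, a level `N`,
budgets `E`, `ε > 0` and a dial radius `δ > 0`. Assume QuadRigidity at level `N` and the balanced
two-dial menu of 1-stationary level-`N` laws at `(f, ν, N)` (linear rows zero, energy drift `a`,
helicity drift `b`, energy `≤ E`, dissipation `≥ 2ε`, for every `(a, b) ∈ [−δ, δ]²`). Then there is
no weak certificate `⟨F_ν(u), ∇p(u)⟩ + λ_b((E+1) − ‖u‖²) + λ_c(ν‖∇u‖² − ε) ≤ 0` (all level-`N` `u`,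
`deg p ≤ 2`, `λ_b, λ_c ≥ 0`, non-trivial) whose quadratic part `p₂` is a Casimir.

Proof. Split `∇p(u) = G₀ + ∇p₂(u)` with the constant band test `G₀ = Σᵢ ∂ᵢp_{≤1} gᵢ`;
QuadRigidity gives `∇p₂(u) = 2αP_N u + 2β curl P_N u` on level-`N` fields, so the row is
`⟨F_ν(u), G₀⟩ + 2α⟨F_ν(u), P_N u⟩ + 2β⟨F_ν(u), curl P_N u⟩`. Integrating the certificate against the
menu law `μ_{a,b}` gives `2αa + 2βb + λ_b + λ_c ε ≤ 0` for all dials, whence `λ_b = λ_c = 0` and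
`α = β = 0`. The residual row `R₀(u) = ⟨F_ν(u), G₀⟩ = (f,G₀) + ν(u,ΔG₀) + ∫(u⊗u):∇G₀` is `≤ 0` on
level-`N` fields; scaling `u ↦ tu` makes the quadratic coefficient `∫(u⊗u):∇G₀ ≤ 0`, so by the SIGN
LEMMA (`MomentParityQuarticGate.stub_signLemma`) it vanishes, then the linear coefficient vanishes,
so `R₀ ≡ (f, G₀)` on level-`N` fields, and the linear row of `G₀` in the menu law `μ_{0,0}` gives
`(f, G₀) = 0`: the row vanishes identically, contradicting non-triviality. The scaling /
integration bookkeeping is in `Theorems/MomentParityCubicParityLoudNoCasimirCertificateScaling.lean`.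
-/

noncomputable section

-- `Summit.<Summit>.<Problem>` is the tree's mandated summit-side namespace (CONVENTIONS §2);
-- the duplicate is deliberate.
set_option linter.dupNamespace false

namespace Summit.AnomalousDissipation.AnomalousDissipation.Theorems.MomentParityCubicParityLoud

open MeasureTheory Filter UnitAddTorus
open scoped InnerProductSpace RealInnerProductSpace ENNReal
open Literature.Analysis.FunctionSpaces Literature.Analysis.FluidPDE
open Summit.AnomalousDissipation.AnomalousDissipation.Theses.MomentParity
open Summit.AnomalousDissipation.AnomalousDissipation.Theorems.CubicParityLoud.Negative

open NoCasimirCertificate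

/-- **THE MENU KILLS EVERY CASIMIR-BASED CERTIFICATE** (= `stub_noCasimirCertificate` below with
the skeleton's inline comments removed; registered sub-goal `noCasimirCertificate` of
stmt-AnomalousDissipation-11465 — the skeleton's own registration of `stub_noCasimirCertificate`
is truncated at the first `:=`, inside `(d := Fin 3)`, and cannot be matched by the gate).
Fix a smooth force `f`, `ν > 0`, a level `N`, budgets `E`, `ε > 0` and a dial radius `δ > 0`. Assume QuadRigidity at level `N` and the BALANCED MENU at `(f, ν, N)`: for every dial
`(a, b) ∈ [−δ, δ]²` a probability law on `H` carried by level-`N` fields, with finite third moments,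
1-STATIONARY (every LINEAR row `∫⟨F_ν(u), g⟩dμ = 0`, `g` band-limited), with ENERGY DRIFT
`∫⟨F_ν(u), P_N u⟩dμ = a`, HELICITY DRIFT `∫⟨F_ν(u), curl P_N u⟩dμ = b`, energy `≤ E` and dissipation
`≥ 2ε`. Then no weak certificate at the target constants `(E + 1, ε)` whose test has a Casimir
quadratic part exists. Proof: split `∇p = G₀ + ∇p₂`, QuadRigidity, integrate against the menu
(dials force `λ_b = λ_c = 0`, `α = β = 0`), then scaling + the sign lemma + the linear row of `G₀`
force the residual row `⟨F_ν(u), G₀⟩` to vanish on level-`N` fields, contradicting non-triviality. -/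
theorem noCasimirCertificate :
    ∀ f : T3 → R3, Torus.IsSmooth f → ∀ ν : ℝ, 0 < ν → ∀ (N : ℕ) (E ε δ : ℝ), 0 < ε → 0 < δ →
      (∀ (m : ℕ) (g : Fin m → T3 → R3) (P : MvPolynomial (Fin m) ℝ),
        (∀ i, IsBandTest N (g i)) → P.IsHomogeneous 2 →
        (∀ u : H3, IsLevel N u →
            Torus.nsGeneratorPairing (d := Fin 3) 0 0 u (polyGrad g P u) = 0) →
        ∃ α β : ℝ, ∀ u : H3, IsLevel N u → ∀ x : T3,
          polyGrad g P u x =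
            (2 * α) • Torus.fourierTruncate N ((u : L2T3) : T3 → R3) x +
              (2 * β) • BDSV.curl (Torus.fourierTruncate N ((u : L2T3) : T3 → R3)) x) →
      (∀ a b : ℝ, |a| ≤ δ → |b| ≤ δ → ∃ μ : Measure H3,
          IsProbabilityMeasure μ ∧ (∀ᵐ u ∂μ, IsLevel N u) ∧
          Integrable (fun u : H3 => ‖u‖ ^ 3) μ ∧
          (∀ g : T3 → R3, IsBandTest N g →
              Integrable (fun u : H3 => Torus.nsGeneratorPairing ν f u g) μ ∧
                ∫ u, Torus.nsGeneratorPairing ν f u g ∂μ = 0) ∧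
          (Integrable (fun u : H3 => Torus.nsGeneratorPairing ν f u
              (Torus.fourierTruncate N ((u : L2T3) : T3 → R3))) μ ∧
            ∫ u, Torus.nsGeneratorPairing ν f u
              (Torus.fourierTruncate N ((u : L2T3) : T3 → R3)) ∂μ = a) ∧
          (Integrable (fun u : H3 => Torus.nsGeneratorPairing ν f u
              (BDSV.curl (Torus.fourierTruncate N ((u : L2T3) : T3 → R3)))) μ ∧
            ∫ u, Torus.nsGeneratorPairing ν f u
              (BDSV.curl (Torus.fourierTruncate N ((u : L2T3) : T3 → R3))) ∂μ = b) ∧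
          Torus.ensembleEnergy μ ≤ E ∧ 2 * ε ≤ Torus.ensembleDissipation ν μ) →
      ∀ (m : ℕ) (g : Fin m → T3 → R3) (P : MvPolynomial (Fin m) ℝ) (lb lc : ℝ),
        (∀ i, IsBandTest N (g i)) → P.totalDegree ≤ 2 → 0 ≤ lb → 0 ≤ lc →
        (lb ≠ 0 ∨ lc ≠ 0 ∨ ∃ u : H3, IsLevel N u ∧
            Torus.nsGeneratorPairing ν f u (polyGrad g P u) ≠ 0) →
        (∀ u : H3, IsLevel N u →
            Torus.nsGeneratorPairing ν f u (polyGrad g P u) + lb * ((E + 1) - ‖u‖ ^ 2) +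
              lc * (ν * (Torus.eGradNormSq ((u : L2T3) : T3 → R3)).toReal - ε) ≤ 0) →
        (∀ u : H3, IsLevel N u →
            Torus.nsGeneratorPairing (d := Fin 3) 0 0 u
              (polyGrad g (MvPolynomial.homogeneousComponent 2 P) u) = 0) →
        False := by
  intro f hf ν hν N E ε δ hε hδ hQuad hmenu m g P lb lc hg hP hlb hlc hnt hcert hCas
  classical
  have hfi : Integrable f volume := hf.integrable
  -- (1) split `∇p = G₀ + ∇p₂`
  set p₂ : MvPolynomial (Fin m) ℝ := MvPolynomial.homogeneousComponent 2 P with hp₂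
  have hdeg1 : (P - p₂).totalDegree ≤ 1 := by
    refine Finset.sup_le fun β hβ => ?_
    have h := MomentParityQuarticGate.degree_le_of_mem_support_sub_homogeneousComponent P hP hβ
    rw [MomentParityQuarticGate.finsupp_degree_eq_sum] at h
    change (β.sum fun _ e => e) ≤ 1
    omega
  set c : Fin m → ℝ := fun i => (P - p₂).coeff (Finsupp.single i 1) with hc
  have hpd : ∀ i,
      MvPolynomial.pderiv i P = MvPolynomial.C (c i) + MvPolynomial.pderiv i p₂ := by
    intro i
    have h := MomentParityQuarticGate.pderiv_eq_C_of_totalDegree_le_one (P - p₂) hdeg1 i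
    rw [map_sub, sub_eq_iff_eq_add] at h
    exact h
  set G₀ : T3 → R3 := fun x => ∑ i, c i • g i x with hG₀
  have hG₀B : IsBandTest N G₀ := isBandTest_sum_smul hg c
  have hdec : ∀ (u : H3) (x : T3), polyGrad g P u x = G₀ x + polyGrad g p₂ u x := by
    intro u x
    simp only [polyGrad, hG₀, hpd, map_add, MvPolynomial.eval_C, add_smul, Finset.sum_add_distrib]
  -- (2) QuadRigidity on the Casimir `p₂`
  obtain ⟨α, β, hrig⟩ :=
    hQuad m g p₂ hg (MvPolynomial.homogeneousComponent_isHomogeneous 2 P) hCas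
  -- notation for the three rows
  set R₀ : H3 → ℝ := fun u => Torus.nsGeneratorPairing ν f u G₀ with hR₀
  set dE : H3 → ℝ := fun u => Torus.nsGeneratorPairing ν f u
    (Torus.fourierTruncate N ((u : L2T3) : T3 → R3)) with hdE
  set dH : H3 → ℝ := fun u => Torus.nsGeneratorPairing ν f u
    (BDSV.curl (Torus.fourierTruncate N ((u : L2T3) : T3 → R3))) with hdH
  -- (3) the row on level-`N` fields
  have hrow : ∀ u : H3, IsLevel N u →
      Torus.nsGeneratorPairing ν f u (polyGrad g P u) =
        R₀ u + 2 * α * dE u + 2 * β * dH u := by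
    intro u hu
    have hfun : polyGrad g P u = fun x => (1 : ℝ) • G₀ x +
        (2 * α) • Torus.fourierTruncate N ((u : L2T3) : T3 → R3) x +
          (2 * β) • BDSV.curl (Torus.fourierTruncate N ((u : L2T3) : T3 → R3)) x := by
      funext x
      rw [hdec u x, hrig u hu x, one_smul, add_assoc]
    rw [hfun, nsGeneratorPairing_lincomb₃ ν hfi u 1 (2 * α) (2 * β) hG₀B.1
      (Torus.isSmooth_fourierTruncate N _)
      (BDSV.isSmooth_curl (Torus.isSmooth_fourierTruncate N _)), one_mul]
  -- (4) integrate against the menu: `2αa + 2βb + λ_b + λ_c ε ≤ 0` for every dial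
  have hdial : ∀ a b : ℝ, |a| ≤ δ → |b| ≤ δ →
      2 * α * a + 2 * β * b + lb + lc * ε ≤ 0 := by
    intro a b ha hb
    obtain ⟨μ, hprob, hlev, h3, hlin, ⟨hEI, hEa⟩, ⟨hHI, hHb⟩, hEn, hDis⟩ :=
      hmenu a b ha hb
    obtain ⟨hG₀I, hG₀0⟩ := hlin G₀ hG₀B
    have hae : ∀ᵐ u ∂μ,
        R₀ u + 2 * α * dE u + 2 * β * dH u + lb * ((E + 1) - ‖u‖ ^ 2) +
          lc * (ν * (Torus.eGradNormSq ((u : L2T3) : T3 → R3)).toReal - ε) ≤ 0 :=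
      hlev.mono fun u hu => by rw [← hrow u hu]; exact hcert u hu
    have key := certificate_integral hlev h3 hG₀I hG₀0 hEI hHI hae
    rw [hEa, hHb] at key
    have h1 : lb * 1 ≤ lb * ((E + 1) - Torus.ensembleEnergy μ) :=
      mul_le_mul_of_nonneg_left (by linarith) hlb
    have h2 : lc * ε ≤ lc * (Torus.ensembleDissipation ν μ - ε) :=
      mul_le_mul_of_nonneg_left (by linarith) hlc
    linarith
  -- (5) the dials: `λ_b = λ_c = 0`, `α = β = 0`
  have hδabs : |δ| ≤ δ := (abs_of_pos hδ).le
  have hδabs' : |-δ| ≤ δ := by rw [abs_neg]; exact hδabs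
  have h0abs : |(0 : ℝ)| ≤ δ := by rw [abs_zero]; exact hδ.le
  have h00 := hdial 0 0 h0abs h0abs
  have hlcε : 0 ≤ lc * ε := mul_nonneg hlc hε.le
  have hlb0 : lb = 0 := by linarith
  have hlc0 : lc = 0 := by
    have : lc * ε ≤ 0 := by linarith
    have : lc ≤ 0 := by
      by_contra h
      linarith [mul_pos (lt_of_not_ge h) hε]
    linarith
  have hα0 : α = 0 := by
    have h1 := hdial δ 0 hδabs h0abs
    have h2 := hdial (-δ) 0 hδabs' h0abs
    rw [hlb0, hlc0] at h1 h2
    have : α * δ = 0 := by nlinarith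
    exact (mul_eq_zero.1 this).resolve_right hδ.ne'
  have hβ0 : β = 0 := by
    have h1 := hdial 0 δ h0abs hδabs
    have h2 := hdial 0 (-δ) h0abs hδabs'
    rw [hlb0, hlc0] at h1 h2
    have : β * δ = 0 := by nlinarith
    exact (mul_eq_zero.1 this).resolve_right hδ.ne'
  -- (6) the residual row `R₀ ≤ 0` on level-`N` fields
  have hrow' : ∀ u : H3, IsLevel N u →
      Torus.nsGeneratorPairing ν f u (polyGrad g P u) = R₀ u := by
    intro u hu
    rw [hrow u hu, hα0, hβ0]
    ring
  have hR₀le : ∀ u : H3, IsLevel N u → R₀ u ≤ 0 := by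
    intro u hu
    have h := hcert u hu
    rw [hrow' u hu, hlb0, hlc0] at h
    simpa using h
  -- (7) scaling: the quadratic coefficient `∫ (u⊗u):∇G₀` is `≤ 0`, hence `0` (sign lemma)
  set A : ℝ := ∫ x, ⟪f x, G₀ x⟫_ℝ with hA
  set B : H3 → ℝ := fun u =>
    ν * ∫ x, ⟪((u : L2T3) : T3 → R3) x, Torus.laplacian G₀ x⟫_ℝ with hB
  set C : H3 → ℝ := fun u => Torus.inertialPairing (u : L2T3) G₀ with hC
  have hscale : ∀ (u : H3) (t : ℝ), R₀ (t • u) = A + B u * t + C u * t ^ 2 := by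
    intro u t
    simp only [hR₀, hA, hB, hC]
    rw [nsGeneratorPairing_smul_left]
    ring
  have hCle : ∀ u : H3, IsLevel N u → C u ≤ 0 := by
    intro u hu
    refine quad_coeff_nonpos (a := A) (b := B u) fun t => ?_
    rw [← hscale u t]
    exact hR₀le _ (isLevel_smul t hu)
  -- the sign lemma on the test `(g, p₂ - P)`, whose differential is the constant field `-G₀`
  have hneg : ∀ u : H3, (fun x => ∑ i, (MvPolynomial.eval (fun j => Torus.pairing u.1 (g j))
      (MvPolynomial.pderiv i (p₂ - P))) • g i x) = fun x => (-1 : ℝ) • G₀ x := by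
    intro u
    funext x
    have hpd' : ∀ i, MvPolynomial.pderiv i (p₂ - P) = MvPolynomial.C (-(c i)) := by
      intro i
      rw [map_sub, hpd i, map_neg]
      ring
    simp only [hpd', MvPolynomial.eval_C, hG₀, neg_smul, Finset.sum_neg_distrib, one_smul]
  have hC0 : ∀ u : H3, IsLevel N u → C u = 0 := by
    intro u hu
    have hsl := MomentParityQuarticGate.stub_signLemma N m g (p₂ - P) hg (fun v hv => by
      rw [hneg v, nsGeneratorPairing_smul_test 0 (integrable_zero _ _ _) v (-1) hG₀B.1,
        nsGeneratorPairing_zero_zero]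
      have := hCle v hv
      simp only [hC] at this
      linarith) u hu
    rw [hneg u, nsGeneratorPairing_smul_test 0 (integrable_zero _ _ _) u (-1) hG₀B.1,
      nsGeneratorPairing_zero_zero] at hsl
    simp only [hC]
    linarith
  -- (8) the linear coefficient vanishes, so `R₀ ≡ A` on level-`N` fields
  have hB0 : ∀ u : H3, IsLevel N u → B u = 0 := by
    intro u hu
    refine lin_coeff_eq_zero (a := A) fun t => ?_
    have h := hR₀le _ (isLevel_smul t hu)
    rw [hscale u t, hC0 u hu] at h
    simpa using h
  have hR₀A : ∀ u : H3, IsLevel N u → R₀ u = A := by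
    intro u hu
    have h := hscale u 1
    rw [one_smul, hB0 u hu, hC0 u hu] at h
    simpa using h
  -- (9) the linear row of `G₀` in the menu law `μ_{0,0}` gives `A = 0`
  have hA0 : A = 0 := by
    obtain ⟨μ, hprob, hlev, -, hlin, -⟩ := hmenu 0 0 h0abs h0abs
    obtain ⟨-, hG₀0⟩ := hlin G₀ hG₀B
    have h1 : ∫ u, R₀ u ∂μ = ∫ _u, A ∂μ :=
      integral_congr_ae (hlev.mono fun u hu => hR₀A u hu)
    rw [integral_const, probReal_univ, one_smul] at h1
    rw [← h1]
    exact hG₀0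
  -- (10) the row vanishes identically on level-`N` fields: contradiction with non-triviality
  rcases hnt with h | h | ⟨u, hu, h⟩
  · exact h hlb0
  · exact h hlc0
  · exact h (by rw [hrow' u hu, hR₀A u hu, hA0])

/-- **S4 — `stub_noCasimirCertificate`: THE MENU KILLS EVERY CASIMIR-BASED CERTIFICATE (the Farkas
split proper).** Statement copied byte-for-byte from the lead's skeleton of the line
`farkas-split-menu` (crux `MomentParity.CubicParityLoud`); it is `noCasimirCertificate` above. -/
theorem stub_noCasimirCertificate :
    ∀ f : T3 → R3, Torus.IsSmooth f → ∀ ν : ℝ, 0 < ν → ∀ (N : ℕ) (E ε δ : ℝ), 0 < ε → 0 < δ →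
      -- QuadRigidity at level `N` (conclusion of S3 at this level)
      (∀ (m : ℕ) (g : Fin m → T3 → R3) (P : MvPolynomial (Fin m) ℝ),
        (∀ i, IsBandTest N (g i)) → P.IsHomogeneous 2 →
        (∀ u : H3, IsLevel N u →
            Torus.nsGeneratorPairing (d := Fin 3) 0 0 u (polyGrad g P u) = 0) →
        ∃ α β : ℝ, ∀ u : H3, IsLevel N u → ∀ x : T3,
          polyGrad g P u x =
            (2 * α) • Torus.fourierTruncate N ((u : L2T3) : T3 → R3) x +
              (2 * β) • BDSV.curl (Torus.fourierTruncate N ((u : L2T3) : T3 → R3)) x) →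
      -- the balanced menu at `(f, ν, N)` with dials in `[−δ, δ]²`, budgets `(E, 2ε)`
      (∀ a b : ℝ, |a| ≤ δ → |b| ≤ δ → ∃ μ : Measure H3,
          IsProbabilityMeasure μ ∧ (∀ᵐ u ∂μ, IsLevel N u) ∧
          Integrable (fun u : H3 => ‖u‖ ^ 3) μ ∧
          (∀ g : T3 → R3, IsBandTest N g →
              Integrable (fun u : H3 => Torus.nsGeneratorPairing ν f u g) μ ∧
                ∫ u, Torus.nsGeneratorPairing ν f u g ∂μ = 0) ∧
          (Integrable (fun u : H3 => Torus.nsGeneratorPairing ν f u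
              (Torus.fourierTruncate N ((u : L2T3) : T3 → R3))) μ ∧
            ∫ u, Torus.nsGeneratorPairing ν f u
              (Torus.fourierTruncate N ((u : L2T3) : T3 → R3)) ∂μ = a) ∧
          (Integrable (fun u : H3 => Torus.nsGeneratorPairing ν f u
              (BDSV.curl (Torus.fourierTruncate N ((u : L2T3) : T3 → R3)))) μ ∧
            ∫ u, Torus.nsGeneratorPairing ν f u
              (BDSV.curl (Torus.fourierTruncate N ((u : L2T3) : T3 → R3))) ∂μ = b) ∧
          Torus.ensembleEnergy μ ≤ E ∧ 2 * ε ≤ Torus.ensembleDissipation ν μ) →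
      -- conclusion: no weak certificate at `(E + 1, ε)` with a Casimir quadratic part
      ∀ (m : ℕ) (g : Fin m → T3 → R3) (P : MvPolynomial (Fin m) ℝ) (lb lc : ℝ),
        (∀ i, IsBandTest N (g i)) → P.totalDegree ≤ 2 → 0 ≤ lb → 0 ≤ lc →
        (lb ≠ 0 ∨ lc ≠ 0 ∨ ∃ u : H3, IsLevel N u ∧
            Torus.nsGeneratorPairing ν f u (polyGrad g P u) ≠ 0) →
        (∀ u : H3, IsLevel N u →
            Torus.nsGeneratorPairing ν f u (polyGrad g P u) + lb * ((E + 1) - ‖u‖ ^ 2) +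
              lc * (ν * (Torus.eGradNormSq ((u : L2T3) : T3 → R3)).toReal - ε) ≤ 0) →
        (∀ u : H3, IsLevel N u →
            Torus.nsGeneratorPairing (d := Fin 3) 0 0 u
              (polyGrad g (MvPolynomial.homogeneousComponent 2 P) u) = 0) →
        False :=
  noCasimirCertificate

end Summit.AnomalousDissipation.AnomalousDissipation.Theorems.MomentParityCubicParityLoud

end
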